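import Summits.NavierStokesRegularity.NavierStokesRegularity.Theorems.HeredityAtOne.Negative.HeredityAtOneFalseOfCappedStageAtOne
import Summits.NavierStokesRegularity.NavierStokesRegularity.Theorems.PalasekTowerBreakdownLocalContinuationHolds

/-! # The cap lever at stub level: `AprioriCeilingAt` is cap-immune, `ReadoutFloorsAt` carries the exposure

The registered line on item stmt-NavierStokesRegularity-19249 splits the first rung LOSSLESSLY,
`HeredityAtOne ↔ LocalContinuationAt 1 ∧ AprioriCeilingAt 1 ∧ ReadoutFloorsAt 1`
(`heredityAtOne_iff_local_apriori_floors`), the first conjunct being a tree THEOREM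
(`palasekTowerBreakdown_localContinuationAt_holds`). This file pushes the T2 r3 ∀-form cap lever
(`not_heredityAt_of_cappedStageAt`: one registered level-`k` stage whose `τ_k`-slice lies in a printed
capped window class `(𝒜, Φ)` with `Φ(u(τ_k)) < c₁ Y_{k+1}` refutes `HeredityAt k`) through that split,
PER STAGE and globally — so that the line's lead knows which `sorry` the lever bears on:

* `ceiling_of_windowSpeedCap` — for a registered stage at level `k ≥ 1` of a QUIET design whose
  `τ_k`-slice lies in `𝒜` with `Φ(u(τ_k)) ≤ c₂ Y_{k+1}`, EVERY finite-energy classical continuation on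
  `[0, T']` (any `T'`; `T' ∈ [τ_k, τ_{k+1}]` in the stub) obeys the a-priori ceiling `c₂ Y_{k+1}` on `[0, T'] × ℝ³` (before `τ_k`:
  the stage's own ceiling `c₂ Y_k ≤ c₂ Y_{k+1}`, `TowerRates.wide_sep`; after: the cap on the silent window).
  So the `AprioriCeilingAt k` instance of a capped stage HOLDS — in particular under the lever's
  `Φ(u(τ_k)) < c₁ Y_{k+1}` (`c₁ ≤ c₂`, `Stage.c₁_le_c₂`): `ceiling_of_windowSpeedCap_lt`.
* `speed_lt_floor_of_windowSpeedCap` / `not_velocityFloor_of_windowSpeedCap` — … while EVERY such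
  continuation to `τ_{k+1}` MISSES the velocity floor at `τ_{k+1}` everywhere: the `ReadoutFloorsAt k`
  instance of a capped stage FAILS as soon as one continuation to `τ_{k+1}` exists (and holds VACUOUSLY
  if none does — which is exactly what `LocalContinuationAt k ∧ AprioriCeilingAt k` excludes).
* Globally: `CappedStageAt k → ContinuationEnvelopeAt k → ¬ ReadoutFloorsAt k` and
  `CappedStageAt k → LocalContinuationAt k → AprioriCeilingAt k → ¬ ReadoutFloorsAt k` (`k ≥ 1`); at the
  first rung, local continuation being a theorem, **`CappedStageAtOne → AprioriCeilingAt 1 →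
  ¬ ReadoutFloorsAt 1`** (`not_readoutFloorsAt_one_of_cappedStageAtOne`): of the line's two `sorry`s it is
  `stub_readout_floors_one` that the cap lever bears on; `stub_apriori_ceiling_at_one` is untouched by it
  (indeed SUPPORTED on the capped stage itself).

Nothing here asserts a route item or a stub; the witness class `CappedStageAt k` stays a HYPOTHESIS (its
emptiness census is the module docstring of `HeredityAtOneFalseOfCappedStageAtOne.lean`, (i)–(iii)).
-/

open Set MeasureTheory
open scoped ENNReal
open Literature.Analysis.FluidPDE
open Summit.NavierStokesRegularity.FluidComputer
open Summit.NavierStokesRegularity.FluidComputer.PalasekTowerClayBridge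
open Summit.NavierStokesRegularity.HeredityAtOneSpeedCap

noncomputable section

namespace Summit.NavierStokesRegularity.HeredityAtOneStubExposure

variable {𝒜 : Set (EuclideanSpace ℝ (Fin 3) → EuclideanSpace ℝ (Fin 3))}
  {Φ : (EuclideanSpace ℝ (Fin 3) → EuclideanSpace ℝ (Fin 3)) → ℝ}
  {S : Schedule TowerRates.wide} {m : Margins TowerRates.wide} {k : ℕ}

/-! ## §1 Per stage: the capped stage's a-priori ceiling HOLDS -/

/-- On the wide register the velocity scale at least doubles per level, so `Y_k ≤ Y_{k+1}`. [folklore] -/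
theorem wide_Y_le_succ (k : ℕ) : TowerRates.wide.Y k ≤ TowerRates.wide.Y (k + 1) := by
  have h2 := TowerRates.wide_sep k
  have hY : 0 < TowerRates.wide.Y k := Real.rpow_pos_of_pos (TowerRates.wide.N_pos k) _
  linarith

/-- **The cap bounds every continuation on the silent window.** A registered stage `s` at level `k ≥ 1`
of a quiet design, `τ_k`-slice in the capped class `𝒜`: every finite-energy classical continuation
`(u, p)` of `s` (design force) on `[0, T']`, `T' ≥ τ_k`, has speed `≤ Φ(u(τ_k))` on `[τ_k, T'] × ℝ³`
(the design force vanishes there, so `(u, p)` is an unforced finite-energy classical flow on the window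
starting at the slice `s.u(τ_k) ∈ 𝒜`). [cite: GallaySverak2016, Prop. 2.6] -/
theorem speed_le_cap_of_windowSpeedCap (hcap : WindowSpeedCap 𝒜 Φ) (hQ : S.Quiet) (hk : 1 ≤ k)
    (s : Stage 1 TowerRates.wide S m k) (hA : s.u (S.τ k) ∈ 𝒜) {T' : ℝ} (hT' : S.τ k < T')
    {u : ℝ → EuclideanSpace ℝ (Fin 3) → EuclideanSpace ℝ (Fin 3)}
    {p : ℝ → EuclideanSpace ℝ (Fin 3) → ℝ}
    (hu : IsClassicalNSSolutionOn (Icc 0 T') 1 S.f u p)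
    (hus : ∀ t ∈ Icc 0 (S.τ k), u t = s.u t ∧ p t = s.p t)
    (hE : ∃ C : ℝ≥0∞, C < ⊤ ∧ ∀ t ∈ Icc 0 T', ∫⁻ x, ‖u t x‖ₑ ^ 2 ≤ C) :
    ∀ t ∈ Icc (S.τ k) T', ∀ x, ‖u t x‖ ≤ Φ (s.u (S.τ k)) := by
  have hcl : IsClassicalNSSolutionOn (Icc (S.τ k) T') 1 S.f u p :=
    hu.mono (Icc_subset_Icc_left (S.τ_pos k).le) (uniqueDiffOn_Icc hT')
  have hf0 : ∀ t ∈ Icc (S.τ k) T', S.f t = 0 := fun t ht => hQ t ((S.τ_mono hk).trans ht.1)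
  have hE' : ∃ C : ℝ≥0∞, C < ⊤ ∧ ∀ t ∈ Icc (S.τ k) T', ∫⁻ x, ‖u t x‖ₑ ^ 2 ≤ C := by
    obtain ⟨C, hC, hb⟩ := hE
    exact ⟨C, hC, fun t ht => hb t ⟨(S.τ_pos k).le.trans ht.1, ht.2⟩⟩
  have hk0 : u (S.τ k) = s.u (S.τ k) := (hus (S.τ k) ⟨(S.τ_pos k).le, le_rfl⟩).1
  have hAk : u (S.τ k) ∈ 𝒜 := by rw [hk0]; exact hA
  intro t ht x
  have hle := hcap hT' S.f u p hcl hf0 hE' hAk t ht x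
  rwa [hk0] at hle

/-- **The `AprioriCeilingAt k` instance of a capped stage HOLDS** (cap-immunity of the upper stub): with
`Φ(u(τ_k)) ≤ c₂ Y_{k+1}`, every finite-energy classical continuation of the stage on `[0, T']` (ANY
`T'`, in particular `T' ∈ [τ_k, τ_{k+1}]` as in `AprioriCeilingAt k`) stays `≤ c₂ Y_{k+1}` on
`[0, T'] × ℝ³` — before `τ_k` by the stage's own ceiling `c₂ Y_k ≤ c₂ Y_{k+1}`, after `τ_k` by the cap. [cite: GallaySverak2016, Prop. 2.6] -/
theorem ceiling_of_windowSpeedCap (hcap : WindowSpeedCap 𝒜 Φ) (hQ : S.Quiet) (hk : 1 ≤ k)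
    (s : Stage 1 TowerRates.wide S m k) (hA : s.u (S.τ k) ∈ 𝒜)
    (hΦ : Φ (s.u (S.τ k)) ≤ S.c₂ * TowerRates.wide.Y (k + 1)) {T' : ℝ}
    {u : ℝ → EuclideanSpace ℝ (Fin 3) → EuclideanSpace ℝ (Fin 3)}
    {p : ℝ → EuclideanSpace ℝ (Fin 3) → ℝ}
    (hu : IsClassicalNSSolutionOn (Icc 0 T') 1 S.f u p)
    (hus : ∀ t ∈ Icc 0 (S.τ k), u t = s.u t ∧ p t = s.p t)
    (hE : ∃ C : ℝ≥0∞, C < ⊤ ∧ ∀ t ∈ Icc 0 T', ∫⁻ x, ‖u t x‖ₑ ^ 2 ≤ C) :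
    ∀ t ∈ Icc 0 T', ∀ x, ‖u t x‖ ≤ S.c₂ * TowerRates.wide.Y (k + 1) := by
  intro t ht x
  have hc₂ : 0 < S.c₂ := s.c₂_pos
  rcases le_or_gt t (S.τ k) with htk | htk
  · rw [(hus t ⟨ht.1, htk⟩).1]
    exact (s.ceiling k le_rfl t ⟨ht.1, htk⟩ x).trans
      (mul_le_mul_of_nonneg_left (wide_Y_le_succ k) hc₂.le)
  · exact (speed_le_cap_of_windowSpeedCap hcap hQ hk s hA (htk.trans_le ht.2) hu hus hE t
      ⟨htk.le, ht.2⟩ x).trans hΦ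

/-- … in particular under the LEVER's hypothesis `Φ(u(τ_k)) < c₁ Y_{k+1}` (`c₁ ≤ c₂` is forced by any
stage, `Stage.c₁_le_c₂`): the cap lever never threatens the a-priori ceiling. [cite: GallaySverak2016, Prop. 2.6] -/
theorem ceiling_of_windowSpeedCap_lt (hcap : WindowSpeedCap 𝒜 Φ) (hQ : S.Quiet) (hk : 1 ≤ k)
    (s : Stage 1 TowerRates.wide S m k) (hA : s.u (S.τ k) ∈ 𝒜)
    (hΦ : Φ (s.u (S.τ k)) < S.c₁ * TowerRates.wide.Y (k + 1)) {T' : ℝ}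
    {u : ℝ → EuclideanSpace ℝ (Fin 3) → EuclideanSpace ℝ (Fin 3)}
    {p : ℝ → EuclideanSpace ℝ (Fin 3) → ℝ}
    (hu : IsClassicalNSSolutionOn (Icc 0 T') 1 S.f u p)
    (hus : ∀ t ∈ Icc 0 (S.τ k), u t = s.u t ∧ p t = s.p t)
    (hE : ∃ C : ℝ≥0∞, C < ⊤ ∧ ∀ t ∈ Icc 0 T', ∫⁻ x, ‖u t x‖ₑ ^ 2 ≤ C) :
    ∀ t ∈ Icc 0 T', ∀ x, ‖u t x‖ ≤ S.c₂ * TowerRates.wide.Y (k + 1) := by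
  have hY : 0 < TowerRates.wide.Y (k + 1) := Real.rpow_pos_of_pos (TowerRates.wide.N_pos (k + 1)) _
  have h12 : S.c₁ * TowerRates.wide.Y (k + 1) ≤ S.c₂ * TowerRates.wide.Y (k + 1) :=
    mul_le_mul_of_nonneg_right s.c₁_le_c₂ hY.le
  exact ceiling_of_windowSpeedCap hcap hQ hk s hA (hΦ.le.trans h12) hu hus hE

/-! ## §2 Per stage: the capped stage's readout floor FAILS for every continuation to `τ_{k+1}` -/

/-- **Every continuation of a capped stage reads BELOW the next floor at `τ_{k+1}`, everywhere**:
`‖u(τ_{k+1}, x)‖ ≤ Φ(u(τ_k)) < c₁ Y_{k+1}` for all `x ∈ ℝ³`. [cite: GallaySverak2016, Prop. 2.6] -/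
theorem speed_lt_floor_of_windowSpeedCap (hcap : WindowSpeedCap 𝒜 Φ) (hQ : S.Quiet) (hk : 1 ≤ k)
    (s : Stage 1 TowerRates.wide S m k) (hA : s.u (S.τ k) ∈ 𝒜)
    (hΦ : Φ (s.u (S.τ k)) < S.c₁ * TowerRates.wide.Y (k + 1))
    {u : ℝ → EuclideanSpace ℝ (Fin 3) → EuclideanSpace ℝ (Fin 3)}
    {p : ℝ → EuclideanSpace ℝ (Fin 3) → ℝ}
    (hu : IsClassicalNSSolutionOn (Icc 0 (S.τ (k + 1))) 1 S.f u p)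
    (hus : ∀ t ∈ Icc 0 (S.τ k), u t = s.u t ∧ p t = s.p t)
    (hE : ∃ C : ℝ≥0∞, C < ⊤ ∧ ∀ t ∈ Icc 0 (S.τ (k + 1)), ∫⁻ x, ‖u t x‖ₑ ^ 2 ≤ C) :
    ∀ x, ‖u (S.τ (k + 1)) x‖ < S.c₁ * TowerRates.wide.Y (k + 1) := fun x =>
  (speed_le_cap_of_windowSpeedCap hcap hQ hk s hA (S.τ_lt_succ k) hu hus hE (S.τ (k + 1))
    ⟨(S.τ_lt_succ k).le, le_rfl⟩ x).trans_lt hΦ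

/-- **The `ReadoutFloorsAt k` instance of a capped stage FAILS** on every continuation to `τ_{k+1}`
(already its first conjunct, the velocity floor `∃ x, ‖x‖ ≤ radius ∧ c₁ Y_{k+1} ≤ ‖u(τ_{k+1}, x)‖`,
is violated — whatever the ceiling hypothesis). [cite: GallaySverak2016, Prop. 2.6] -/
theorem not_velocityFloor_of_windowSpeedCap (hcap : WindowSpeedCap 𝒜 Φ) (hQ : S.Quiet) (hk : 1 ≤ k)
    (s : Stage 1 TowerRates.wide S m k) (hA : s.u (S.τ k) ∈ 𝒜)
    (hΦ : Φ (s.u (S.τ k)) < S.c₁ * TowerRates.wide.Y (k + 1))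
    {u : ℝ → EuclideanSpace ℝ (Fin 3) → EuclideanSpace ℝ (Fin 3)}
    {p : ℝ → EuclideanSpace ℝ (Fin 3) → ℝ}
    (hu : IsClassicalNSSolutionOn (Icc 0 (S.τ (k + 1))) 1 S.f u p)
    (hus : ∀ t ∈ Icc 0 (S.τ k), u t = s.u t ∧ p t = s.p t)
    (hE : ∃ C : ℝ≥0∞, C < ⊤ ∧ ∀ t ∈ Icc 0 (S.τ (k + 1)), ∫⁻ x, ‖u t x‖ₑ ^ 2 ≤ C) :
    ¬ ∃ x, ‖x‖ ≤ S.radius ∧ S.c₁ * TowerRates.wide.Y (k + 1) ≤ ‖u (S.τ (k + 1)) x‖ := by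
  rintro ⟨x, -, hx⟩
  exact absurd hx (not_le.2 (speed_lt_floor_of_windowSpeedCap hcap hQ hk s hA hΦ hu hus hE x))

/-! ## §3 Globally: the lever bears on the LOWER stub -/

/-- **`H_cap(k) → ContinuationEnvelopeAt k → ¬ ReadoutFloorsAt k`** (`k ≥ 1`): given the upper half, the
cap lever's target is the readout-floor half (`heredityAt_iff_envelopeAt_and_floorsAt`). [cite: Palasek2026ElementaryModel, §4] -/
theorem not_readoutFloorsAt_of_cappedStageAt_of_envelope (hk : 1 ≤ k) (hW : CappedStageAt k)
    (hEnv : ContinuationEnvelopeAt k) : ¬ ReadoutFloorsAt k := fun hF =>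
  not_heredityAt_of_cappedStageAt hk hW (heredityAt_iff_envelopeAt_and_floorsAt.2 ⟨hEnv, hF⟩)

/-- **`H_cap(k) → LocalContinuationAt k → AprioriCeilingAt k → ¬ ReadoutFloorsAt k`** (`k ≥ 1`; the
three-stub split `heredityAt_iff_local_apriori_floors`). [cite: Palasek2026ElementaryModel, §4] -/
theorem not_readoutFloorsAt_of_cappedStageAt_of_apriori (hk : 1 ≤ k) (hW : CappedStageAt k)
    (hL : LocalContinuationAt k) (hA : AprioriCeilingAt k) : ¬ ReadoutFloorsAt k := fun hF =>
  not_heredityAt_of_cappedStageAt hk hW ((heredityAt_iff_local_apriori_floors hk).2 ⟨hL, hA, hF⟩)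

/-- **At the first rung: `H_cap(1) → AprioriCeilingAt 1 → ¬ ReadoutFloorsAt 1`** — local continuation
across `τ₁` is a tree THEOREM (`palasekTowerBreakdown_localContinuationAt_holds`), so of the registered
line's two `sorry`s (`stub_apriori_ceiling_at_one`, `stub_readout_floors_one`) the cap lever bears on
`stub_readout_floors_one`; by §1 it never threatens `stub_apriori_ceiling_at_one` on the capped stage.
[cite: Palasek2026ElementaryModel, §4] -/
theorem not_readoutFloorsAt_one_of_cappedStageAtOne (hW : CappedStageAtOne) (hA : AprioriCeilingAt 1) :
    ¬ ReadoutFloorsAt 1 :=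
  not_readoutFloorsAt_of_cappedStageAt_of_apriori le_rfl hW
    (Summit.NavierStokesRegularity.NavierStokesRegularity.Theorems.palasekTowerBreakdown_localContinuationAt_holds
      1) hA

/-- Equivalently: under `H_cap(1)` the two registered stubs cannot BOTH hold. [cite: Palasek2026ElementaryModel, §4] -/
theorem not_apriori_and_floors_one_of_cappedStageAtOne (hW : CappedStageAtOne) :
    ¬ (AprioriCeilingAt 1 ∧ ReadoutFloorsAt 1) := fun h =>
  not_readoutFloorsAt_one_of_cappedStageAtOne hW h.1 h.2

end Summit.NavierStokesRegularity.HeredityAtOneStubExposure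

end
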